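import Literature.Probability.LatticeModels.GibbsSpecification
import Literature.Probability.LatticeModels.IsingConsistency
import HarnessLib

/-!
# The Ising kernels form a specification: discharge of `isSpecification_isingSpecification`

Companion ("Proofs") file of `Literature/Probability/LatticeModels/GibbsSpecification.lean`
(trunk G02, T-STATMECH). That file defines Georgii's specification axioms `IsSpecification γ`
(probability, `𝓕_{Λᶜ}`-measurability in the boundary condition, properness, consistency;
Georgii 2011, Def. 1.23; Friedli–Velenik 2017, Def. 6.9) and records as NAMED FACTS that the
finite-volume Ising measures `γ_Λ(· | η) = μ^η_{Λ;β,h}` of a locally finite graph with countable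
vertex set satisfy them (`isSpecification_isingSpecification`, Friedli–Velenik 2017, Lemma 6.7 and
Thm. 6.8; Georgii 2011, Ex. 2.12 with Prop. 2.5) and the `ℤ^d` instance
(`isSpecification_isingSpecification_zd`). Both are PROVED here:

* `measurable_boundary_glue`, `measurable_isingMeasure_fixed` — `η ↦ μ^η_Λ(A)` is
  `𝓕_{Λᶜ}`-measurable (the Boltzmann sum `isingMeasure_apply_of_measurableSet` is a finite sum of
  measurable functions of the boundary spins);
* `ae_eqOn_compl_isingMeasure_fixed` — properness (`[Countable V]`): `μ^η_Λ`-a.e. configuration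
  equals `η` off `Λ` (the reference measure is carried by the glued configurations and
  `Measure.tilted` is absolutely continuous);
* `lintegral_isingMeasure` — `∫⁻ F dμ^{bc}_Λ = ∑_τ (w(τ)/Z) F(τ ∨ bc)`;
* `lintegral_isingMeasure_fixed_consistent` — consistency `γ_{Λ'} γ_Λ = γ_{Λ'}` for `Λ ⊆ Λ'`
  (Friedli–Velenik 2017, Lemma 6.7: the two-step decomposition of the Boltzmann sums,
  `exists_sum_isingWeight_fixed_eq` of `IsingConsistency.lean`, applied to `1_A` and to
  `ζ ↦ μ^ζ_Λ(A)`, which depends on `ζ` only off `Λ`);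
* `isSpecification_isingSpecification_holds : isSpecification_isingSpecification G` and
  `isSpecification_isingSpecification_zd_holds : isSpecification_isingSpecification_zd`.
* `isGibbsMeasure_iff_bind_holds : isGibbsMeasure_iff_bind` — the junk-free DLR equations
  `∫⁻ η, γ Λ η A ∂μ = μ A` of `IsGibbsMeasure` are the monadic ones `μ.bind (γ Λ) = μ`
  (Georgii 2011, Def. 1.23 / Rem. 1.24, `μ γ_Λ = μ`; Friedli–Velenik 2017, Def. 6.12 with
  (6.19)–(6.20)): a specification kernel is measurable into the Giry σ-algebra
  (`cylinderEvents_le_pi`, `Measure.measurable_of_measurable_coe`), so `Measure.bind_apply` applies.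
* `isProbabilityMeasure_gibbsSpecOfPotential_holds : isProbabilityMeasure_gibbsSpecOfPotential` —
  for a nonzero finite a priori measure `ν` and a potential `Φ` with measurable, bounded
  interaction terms, the finite-volume Gibbs distribution `gibbsSpecOfPotential ν Φ supp β Λ η`
  (Mathlib `Measure.tilted` of `ν^{⊗Λ} ∘ glueWith⁻¹` by `-β H_Λ^Φ`) is a probability measure
  (Georgii 2011, Def. 2.9 with (2.9); Friedli–Velenik 2017, §6.3.2, (6.30)–(6.31)):
  `map_glueWith_pi_ne_zero` (the reference measure has mass `ν(S)^{|Λ|} ≠ 0`),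
  `abs_hamiltonianIn_le` (`|H_Λ^Φ| ≤ ∑_A ‖Φ_A‖_∞`), `measurable_hamiltonianIn`, then Mathlib
  `Integrable.of_bound` and `isProbabilityMeasure_tilted`.

* `convex_gibbsMeasures_holds : convex_gibbsMeasures` — `𝒢(γ)` is convex (Georgii 2011, Ch. 7,
  (7.1); Friedli–Velenik 2017, Thm. 6.56): the DLR equation `∫ γ_Λ(A | η) dμ(η) = μ(A)` is linear
  in `μ` (`lintegral_add_measure`, `lintegral_smul_measure`), and `(a • μ + b • ν)(Ω) = a + b = 1`;
  no hypothesis on `γ`.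

No new definitions, no named facts. Mathlib anchors: `lintegral_tilted`, `lintegral_map`,
`lintegral_count`, `tilted_absolutelyContinuous`, `ae_map_iff`, `measurable_restrict_cylinderEvents`,
`Measurable.ite`, `ENNReal.ofReal_sum_of_nonneg`, `Measure.bind_apply`,
`Measure.measurable_of_measurable_coe`, `cylinderEvents_le_pi`, `isProbabilityMeasure_tilted`,
`Integrable.of_bound`, `Measure.pi_univ`, `Measure.map_ne_zero_iff`, `lintegral_add_measure`,
`lintegral_smul_measure`.
-/

noncomputable section

open MeasureTheory Finset
open scoped ENNReal

namespace Literature.Probability.LatticeModels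

variable {V : Type*} (G : SimpleGraph V) [DecidableEq V] [G.LocallyFinite]

/-! ### Measurability in the boundary condition -/

omit [DecidableEq V] [G.LocallyFinite] in
/-- Gluing a fixed finite configuration `τ` into the boundary condition `η` is measurable from
the outside σ-algebra `𝓕_{Λᶜ}` to the product σ-algebra (it factors through the restriction
`η ↦ η|_{Λᶜ}`). (Georgii 2011, Def. 1.23 (ii); Friedli–Velenik 2017, Lemma 6.7.)
[cite: Georgii2011, Def. 1.23] -/
theorem measurable_boundary_glue (Λ : Finset V) (τ : Λ → ℤˣ) :
    Measurable[cylinderEvents (X := fun _ : V => ℤˣ) ((↑Λ : Set V)ᶜ)]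
      fun η : SpinConfig V => glue Λ τ (.fixed η) := by
  classical
  let g : (((↑Λ : Set V)ᶜ : Set V) → ℤˣ) → SpinConfig V := fun ρ y =>
    if hy : y ∈ Λ then τ ⟨y, hy⟩ else ρ ⟨y, by simpa using hy⟩
  have hg : Measurable g := measurable_pi_lambda _ fun y => by
    by_cases hy : y ∈ Λ
    · simp only [g, hy, dite_true]
      exact measurable_const
    · simp only [g, hy, dite_false]
      exact measurable_pi_apply _
  have hfac : (fun η : SpinConfig V => glue Λ τ (.fixed η)) =
      g ∘ Set.restrict ((↑Λ : Set V)ᶜ) := by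
    funext η; funext y
    by_cases hy : y ∈ Λ
    · simp [g, hy]
    · simp [g, hy]
  rw [hfac]
  exact hg.comp (measurable_restrict_cylinderEvents _)

omit [DecidableEq V] [G.LocallyFinite] in
/-- The fixed-boundary Hamiltonian does not depend on the name of the boundary configuration in
its boundary-condition slot (the interacting edge set is `ℰ^b_Λ` for every fixed condition; the
boundary spins enter only through the configuration argument). [cite: FriedliVelenik2017, §3.1 eq. (3.6)] -/
theorem isingHamiltonian_fixed_eq_fixed_one [DecidableEq V] [G.LocallyFinite] (Λ : Finset V)
    (h : ℝ) (η : SpinConfig V) (σ : SpinConfig V) :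
    isingHamiltonian G Λ h (.fixed η) σ = isingHamiltonian G Λ h (.fixed 1) σ := by
  simp only [isingHamiltonian, interactionEdges_fixed]

/-- **`𝓕_{Λᶜ}`-measurability of the Ising kernels** (Georgii 2011, Def. 1.23 (ii);
Friedli–Velenik 2017, Lemma 6.7 / Def. 6.9): for every measurable `A`, the boundary condition
`η ↦ μ^η_{Λ;β,h}(A)` is measurable for the outside σ-algebra. Proof: by
`isingMeasure_apply_of_measurableSet`, `μ^η_Λ(A) = (∑_τ 1_A(τ ∨ η) w^η(τ)) / Z^η`, a finite
combination of measurable functions of `η|_{Λᶜ}`. [cite: Georgii2011, Def. 1.23] -/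
theorem measurable_isingMeasure_fixed (Λ : Finset V) (β h : ℝ) {A : Set (SpinConfig V)}
    (hA : MeasurableSet A) :
    Measurable[cylinderEvents (X := fun _ : V => ℤˣ) ((↑Λ : Set V)ᶜ)]
      fun η : SpinConfig V => isingMeasure G Λ β h (.fixed η) A := by
  classical
  -- the Boltzmann weight of `τ` as a measurable function of the boundary condition
  have hw : ∀ τ : Λ → ℤˣ, Measurable[cylinderEvents (X := fun _ : V => ℤˣ) ((↑Λ : Set V)ᶜ)]
      fun η : SpinConfig V => isingWeight G Λ β h (.fixed η) τ := by
    intro τ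
    have : (fun η : SpinConfig V => isingWeight G Λ β h (.fixed η) τ) =
        fun η => Real.exp (-β * isingHamiltonian G Λ h (.fixed 1) (glue Λ τ (.fixed η))) := by
      funext η
      rw [isingWeight, isingHamiltonian_fixed_eq_fixed_one]
    rw [this]
    exact Real.measurable_exp.comp
      (((measurable_isingHamiltonian G Λ h (.fixed 1)).comp
        (measurable_boundary_glue Λ τ)).const_mul _)
  have hZ : Measurable[cylinderEvents (X := fun _ : V => ℤˣ) ((↑Λ : Set V)ᶜ)]
      fun η : SpinConfig V => isingPartitionFunction G Λ β h (.fixed η) := by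
    simp only [isingPartitionFunction]
    exact Finset.measurable_sum _ fun τ _ => hw τ
  have hind : ∀ τ : Λ → ℤˣ, Measurable[cylinderEvents (X := fun _ : V => ℤˣ) ((↑Λ : Set V)ᶜ)]
      fun η : SpinConfig V =>
        if glue Λ τ (.fixed η) ∈ A then isingWeight G Λ β h (.fixed η) τ else 0 := by
    intro τ
    refine Measurable.ite ?_ (hw τ) measurable_const
    exact measurable_boundary_glue Λ τ hA
  have hform : (fun η : SpinConfig V => isingMeasure G Λ β h (.fixed η) A) = fun η =>
      ENNReal.ofReal ((∑ τ : Λ → ℤˣ,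
          if glue Λ τ (.fixed η) ∈ A then isingWeight G Λ β h (.fixed η) τ else 0) /
        isingPartitionFunction G Λ β h (.fixed η)) := by
    funext η
    rw [isingMeasure_apply_of_measurableSet G Λ β h (.fixed η) hA, Finset.sum_filter]
  rw [hform]
  exact ((Finset.measurable_sum _ fun τ _ => hind τ).div hZ).ennreal_ofReal

/-! ### Integration against the finite-volume measure and properness -/

omit [DecidableEq V] [G.LocallyFinite] in
/-- **Integration against `μ^{bc}_{Λ;β,h}` is a Boltzmann sum**:
`∫⁻ F dμ^{bc}_Λ = ∑_τ (w(τ)/Z) · F(τ ∨ bc)` for measurable `F ≥ 0`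
(Friedli–Velenik 2017, §3.1, Def. 3.1 and eq. (3.7)). [cite: FriedliVelenik2017, §3.1 Def. 3.1] -/
theorem lintegral_isingMeasure [DecidableEq V] [G.LocallyFinite] (Λ : Finset V) (β h : ℝ)
    (bc : BoundaryCondition V) {F : SpinConfig V → ℝ≥0∞} (hF : Measurable F) :
    ∫⁻ σ, F σ ∂(isingMeasure G Λ β h bc) =
      ∑ τ : Λ → ℤˣ, ENNReal.ofReal (isingWeight G Λ β h bc τ / isingPartitionFunction G Λ β h bc) *
        F (glue Λ τ bc) := by
  have href : ∀ {H : SpinConfig V → ℝ≥0∞}, Measurable H →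
      ∫⁻ σ, H σ ∂(isingRef Λ bc) = ∑ τ : Λ → ℤˣ, H (glue Λ τ bc) := fun hH => by
    rw [isingRef, lintegral_map hH (measurable_glue Λ bc), lintegral_count, tsum_fintype]
  have hm : Measurable fun σ : SpinConfig V =>
      ENNReal.ofReal (Real.exp (-β * isingHamiltonian G Λ h bc σ) /
        isingPartitionFunction G Λ β h bc) * F σ := by
    refine Measurable.mul ?_ hF
    exact ((Real.measurable_exp.comp ((measurable_isingHamiltonian G Λ h bc).const_mul _)).div
      measurable_const).ennreal_ofReal
  rw [isingMeasure, lintegral_tilted, integral_exp_isingRef, href hm]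
  rfl

/-- **Properness of the Ising kernels** (Georgii 2011, Def. 1.23 (ii); Friedli–Velenik 2017,
§6.2, `μ^η_Λ(Ω^η_Λ) = 1`): for a countable vertex set, `μ^η_{Λ;β,h}`-almost every configuration
agrees with `η` outside `Λ`. (The reference measure is the image of the counting measure under
gluing into `η`, and `Measure.tilted` is absolutely continuous with respect to it; countability
makes the event measurable.) [cite: Georgii2011, Def. 1.23] -/
theorem ae_eqOn_compl_isingMeasure_fixed [Countable V] (Λ : Finset V) (β h : ℝ)
    (η : SpinConfig V) :
    ∀ᵐ σ ∂(isingMeasure G Λ β h (.fixed η)), ∀ x ∉ Λ, σ x = η x := by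
  have hS : MeasurableSet {σ : SpinConfig V | ∀ x ∉ Λ, σ x = η x} := by
    have : {σ : SpinConfig V | ∀ x ∉ Λ, σ x = η x} =
        ⋂ x ∈ ((↑Λ : Set V)ᶜ), (fun σ : SpinConfig V => σ x) ⁻¹' {η x} := by
      ext σ; simp
    rw [this]
    exact MeasurableSet.biInter (Set.to_countable _) fun x _ =>
      measurable_pi_apply x (measurableSet_singleton _)
  have href : ∀ᵐ σ ∂(isingRef Λ (.fixed η)), ∀ x ∉ Λ, σ x = η x := by
    rw [isingRef, ae_map_iff (measurable_glue Λ _).aemeasurable hS]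
    exact ae_of_all _ fun τ x hx => by
      rw [glue_apply_of_notMem _ _ _ hx, BoundaryCondition.outside_fixed]
  exact href.filter_mono (tilted_absolutelyContinuous _ _).ae_le

/-! ### Consistency -/

omit [G.LocallyFinite] in
/-- Gluing into two boundary conditions that agree off `Λ` gives the same configuration.
[cite: FriedliVelenik2017, §3.1] -/
theorem glue_fixed_congr_of_eqOn_compl [G.LocallyFinite] {Λ : Finset V} {ζ ζ' : SpinConfig V}
    (hζ : ∀ x ∉ Λ, ζ x = ζ' x) (τ : Λ → ℤˣ) :
    glue Λ τ (.fixed ζ) = glue Λ τ (.fixed ζ') := by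
  funext x
  by_cases hx : x ∈ Λ
  · rw [glue_apply_of_mem _ _ _ hx, glue_apply_of_mem _ _ _ hx]
  · rw [glue_apply_of_notMem _ _ _ hx, glue_apply_of_notMem _ _ _ hx,
      BoundaryCondition.outside_fixed, BoundaryCondition.outside_fixed, hζ x hx]

/-- The finite-volume measure `μ^ζ_Λ(A)` depends on `ζ` only through `ζ|_{Λᶜ}`.
[cite: FriedliVelenik2017, §3.6.3, eq. (3.26)] -/
theorem isingMeasure_fixed_congr_of_eqOn_compl (Λ : Finset V) (β h : ℝ) {ζ ζ' : SpinConfig V}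
    (hζ : ∀ x ∉ Λ, ζ x = ζ' x) {A : Set (SpinConfig V)} (hA : MeasurableSet A) :
    isingMeasure G Λ β h (.fixed ζ) A = isingMeasure G Λ β h (.fixed ζ') A := by
  classical
  have hbd : ∀ y ∈ outerBoundary G Λ, ζ y = ζ' y := fun y hy =>
    hζ y (mem_outerBoundary_iff.1 hy).1
  rw [isingMeasure_apply_of_measurableSet G Λ β h (.fixed ζ) hA,
    isingMeasure_apply_of_measurableSet G Λ β h (.fixed ζ') hA,
    isingPartitionFunction_fixed_congr_outerBoundary G hbd β h]
  congr 2
  rw [Finset.sum_filter, Finset.sum_filter]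
  refine Finset.sum_congr rfl fun τ _ => ?_
  rw [glue_fixed_congr_of_eqOn_compl G hζ τ, isingWeight_fixed_congr_outerBoundary G hbd β h τ]

/-- **Consistency of the Ising kernels** (Friedli–Velenik 2017, Lemma 6.7 (compatibility
`μ^η_Λ(μ^·_Δ(A)) = μ^η_Λ(A)` for `Δ ⊆ Λ`); Georgii 2011, Def. 1.23 (iii)): for `Λ ⊆ Λ'`,
`∫ μ^σ_{Λ;β,h}(A) dμ^η_{Λ';β,h}(σ) = μ^η_{Λ';β,h}(A)`. Proof: both sides are Boltzmann sums over
the configurations of `Λ'`; by the two-step decomposition (`exists_sum_isingWeight_fixed_eq`: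
first the spins of `Λ' ∖ Λ`, updating the boundary condition to `η[τ₂]`, then the spins of `Λ`)
applied to `1_A` and to `ζ ↦ μ^ζ_Λ(A)` — which depends on `ζ` only off `Λ`, so that the inner
sum over the spins of `Λ` gives `Z^{η[τ₂]}_Λ · μ^{η[τ₂]}_Λ(A) = ∑_{τ₁ : τ₁ ∨ η[τ₂] ∈ A} w(τ₁)` —
the two sums agree term by term in `τ₂`. [cite: FriedliVelenik2017, Lemma 6.7] -/
theorem lintegral_isingMeasure_fixed_consistent {Λ Λ' : Finset V} (hsub : Λ ⊆ Λ') (β h : ℝ)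
    (η : SpinConfig V) {A : Set (SpinConfig V)} (hA : MeasurableSet A) :
    ∫⁻ σ, isingMeasure G Λ β h (.fixed σ) A ∂(isingMeasure G Λ' β h (.fixed η)) =
      isingMeasure G Λ' β h (.fixed η) A := by
  classical
  -- notation
  have hZ'pos : 0 < isingPartitionFunction G Λ' β h (.fixed η) := isingPartitionFunction_pos G Λ' β h _
  -- `q ζ = μ^ζ_Λ(A)` as a real number: `S_A(ζ) / Z_Λ(ζ)`
  set S : SpinConfig V → ℝ := fun ζ =>
    ∑ τ : Λ → ℤˣ, if glue Λ τ (.fixed ζ) ∈ A then isingWeight G Λ β h (.fixed ζ) τ else 0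
    with hS
  set q : SpinConfig V → ℝ := fun ζ => S ζ / isingPartitionFunction G Λ β h (.fixed ζ) with hq
  have hq_nonneg : ∀ ζ, 0 ≤ q ζ := fun ζ =>
    div_nonneg (Finset.sum_nonneg fun τ _ => by
      split_ifs
      · exact (isingWeight_pos G Λ β h _ τ).le
      · exact le_rfl) (isingPartitionFunction_pos G Λ β h _).le
  have hμΛ : ∀ ζ, isingMeasure G Λ β h (.fixed ζ) A = ENNReal.ofReal (q ζ) := fun ζ => by
    rw [isingMeasure_apply_of_measurableSet G Λ β h (.fixed ζ) hA, Finset.sum_filter]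
  -- `q` depends on `ζ` only off `Λ`
  have hq_congr : ∀ ζ ζ' : SpinConfig V, (∀ x ∉ Λ, ζ x = ζ' x) → q ζ = q ζ' := by
    intro ζ ζ' hζ
    have h1 := isingMeasure_fixed_congr_of_eqOn_compl G Λ β h hζ hA
    rw [hμΛ, hμΛ] at h1
    exact (ENNReal.ofReal_eq_ofReal_iff (hq_nonneg ζ) (hq_nonneg ζ')).1 h1
  -- `Z_Λ(ζ) q(ζ) = S(ζ)`
  have hZq : ∀ ζ, (∑ τ : Λ → ℤˣ, isingWeight G Λ β h (.fixed ζ) τ) * q ζ = S ζ := fun ζ => by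
    rw [hq]
    exact mul_div_cancel₀ _ (isingPartitionFunction_pos G Λ β h (.fixed ζ)).ne'
  -- left-hand side as a Boltzmann sum over `Λ'`
  have hLHS : ∫⁻ σ, isingMeasure G Λ β h (.fixed σ) A ∂(isingMeasure G Λ' β h (.fixed η)) =
      ENNReal.ofReal ((∑ τ' : Λ' → ℤˣ, isingWeight G Λ' β h (.fixed η) τ' *
        q (glue Λ' τ' (.fixed η))) / isingPartitionFunction G Λ' β h (.fixed η)) := by
    have hmeas : Measurable fun σ : SpinConfig V => isingMeasure G Λ β h (.fixed σ) A :=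
      (measurable_isingMeasure_fixed G Λ β h hA).mono cylinderEvents_le_pi le_rfl
    rw [lintegral_isingMeasure G Λ' β h (.fixed η) hmeas, Finset.sum_div,
      ENNReal.ofReal_sum_of_nonneg (fun τ' _ => div_nonneg
        (mul_nonneg (isingWeight_pos G Λ' β h _ τ').le (hq_nonneg _)) hZ'pos.le)]
    refine Finset.sum_congr rfl fun τ' _ => ?_
    rw [hμΛ, ← ENNReal.ofReal_mul (div_nonneg (isingWeight_pos G Λ' β h _ τ').le hZ'pos.le)]
    congr 1
    ring
  -- right-hand side as a Boltzmann sum over `Λ'`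
  have hRHS : isingMeasure G Λ' β h (.fixed η) A =
      ENNReal.ofReal ((∑ τ' : Λ' → ℤˣ, isingWeight G Λ' β h (.fixed η) τ' *
        (if glue Λ' τ' (.fixed η) ∈ A then (1 : ℝ) else 0)) /
          isingPartitionFunction G Λ' β h (.fixed η)) := by
    rw [isingMeasure_apply_of_measurableSet G Λ' β h (.fixed η) hA, Finset.sum_filter]
    congr 3
    funext τ'
    split_ifs <;> simp
  rw [hLHS, hRHS]
  congr 2
  -- the two-step decomposition, applied to `q` and to `1_A`
  obtain ⟨R, -, hR⟩ := exists_sum_isingWeight_fixed_eq G hsub η β h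
  rw [hR q, hR (fun σ => if σ ∈ A then (1 : ℝ) else 0)]
  refine Finset.sum_congr rfl fun τ₂ _ => ?_
  congr 1
  set η₂ : SpinConfig V := glue (Λ' \ Λ) τ₂ (.fixed η) with hη₂
  -- inner sums: `∑_{τ₁} w^{η₂}_Λ(τ₁) q(τ₁ ∨ η₂) = Z_Λ(η₂) q(η₂) = S(η₂) = ∑_{τ₁} w 1_A`
  have hinner : ∀ τ₁ : Λ → ℤˣ, q (glue Λ τ₁ (.fixed η₂)) = q η₂ := fun τ₁ =>
    hq_congr _ _ fun x hx => by
      rw [glue_apply_of_notMem _ _ _ hx, BoundaryCondition.outside_fixed]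
  calc ∑ τ₁ : Λ → ℤˣ, isingWeight G Λ β h (.fixed η₂) τ₁ * q (glue Λ τ₁ (.fixed η₂))
      = (∑ τ₁ : Λ → ℤˣ, isingWeight G Λ β h (.fixed η₂) τ₁) * q η₂ := by
        rw [Finset.sum_mul]
        exact Finset.sum_congr rfl fun τ₁ _ => by rw [hinner τ₁]
    _ = S η₂ := hZq η₂
    _ = ∑ τ₁ : Λ → ℤˣ, isingWeight G Λ β h (.fixed η₂) τ₁ *
          (if glue Λ τ₁ (.fixed η₂) ∈ A then (1 : ℝ) else 0) := by
        rw [hS]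
        refine Finset.sum_congr rfl fun τ₁ _ => ?_
        split_ifs <;> simp

/-! ### The discharges -/

/-- **Discharge of `isSpecification_isingSpecification`** (Friedli–Velenik 2017, Lemma 6.7 and
Thm. 6.8; Georgii 2011, Ex. 2.12 with Prop. 2.5): on a locally finite graph with countable vertex
set the fixed-boundary Ising measures form a specification in Georgii's sense — probability
(`isingMeasure.instIsProbabilityMeasure`), `𝓕_{Λᶜ}`-measurability
(`measurable_isingMeasure_fixed`), properness (`ae_eqOn_compl_isingMeasure_fixed`) and
consistency (`lintegral_isingMeasure_fixed_consistent`); no sign condition on `β`.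
[cite: FriedliVelenik2017, Lemma 6.7 and Thm. 6.8] -/
theorem isSpecification_isingSpecification_holds : isSpecification_isingSpecification G := by
  intro _ β h
  exact
    { isProbability := fun Λ η => by
        rw [isingSpecification_apply]; infer_instance
      measurable := fun Λ A hA => measurable_isingMeasure_fixed G Λ β h hA
      proper := fun Λ η => ae_eqOn_compl_isingMeasure_fixed G Λ β h η
      consistent := fun Λ Λ' hsub η A hA =>
        lintegral_isingMeasure_fixed_consistent G hsub β h η hA }

/-- **Discharge of `isSpecification_isingSpecification_zd`**: the Ising kernels on `ℤ^d` form a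
specification (`Site d` is countable). [cite: FriedliVelenik2017, Lemma 6.7 and Thm. 6.8] -/
theorem isSpecification_isingSpecification_zd_holds : isSpecification_isingSpecification_zd :=
  fun d β h => isSpecification_isingSpecification_holds (zdGraph d) β h

/-! ### The monadic form of the DLR equations: discharge of `isGibbsMeasure_iff_bind` -/

section Bind

variable {S : Type*} [MeasurableSpace S]

omit [DecidableEq V] [G.LocallyFinite] in
/-- **Discharge of `isGibbsMeasure_iff_bind`.** For a specification `γ`, every kernel
`γ Λ : (V → S) → Measure (V → S)` is measurable from the product σ-algebra into the Giry
σ-algebra (its `𝓕_{Λᶜ}`-measurability `IsSpecification.measurable` combined with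
`cylinderEvents_le_pi` and `Measure.measurable_of_measurable_coe`), hence
`(μ.bind (γ Λ)) A = ∫⁻ η, γ Λ η A ∂μ` for measurable `A` (Mathlib `Measure.bind_apply`), so the
junk-free DLR equations `∫⁻ η, γ Λ η A ∂μ = μ A` of `IsGibbsMeasure` say exactly
`μ.bind (γ Λ) = μ`, i.e. Georgii's `μ γ_Λ = μ` for all `Λ ∈ 𝒮` (Georgii 2011, Def. 1.23 and
Rem. 1.24; Friedli–Velenik 2017, Def. 6.12 with (6.19)–(6.20): `μ π_Λ(A) = ∫ π_Λ(A | ω) μ(dω)`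
and `μ ∈ 𝒢(π) ⇔ μ = μ π_Λ ∀ Λ`). [cite: Georgii2011, Def. 1.23 / Rem. 1.24] -/
theorem isGibbsMeasure_iff_bind_holds : isGibbsMeasure_iff_bind (V := V) (S := S) := by
  intro γ hγ μ
  have hmeas : ∀ Λ : Finset V, Measurable (γ Λ) := fun Λ =>
    Measure.measurable_of_measurable_coe _ fun A hA =>
      (hγ.measurable Λ A hA).mono cylinderEvents_le_pi le_rfl
  have hbind : ∀ (Λ : Finset V) {A : Set (V → S)}, MeasurableSet A →
      μ.bind (γ Λ) A = ∫⁻ η, γ Λ η A ∂μ := fun Λ A hA =>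
    Measure.bind_apply hA (hmeas Λ).aemeasurable
  refine ⟨fun h => ⟨h.1, fun Λ => Measure.ext fun A hA => ?_⟩, fun h => ⟨h.1, fun Λ A hA => ?_⟩⟩
  · rw [hbind Λ hA, h.2 Λ A hA]
  · rw [← hbind Λ hA, h.2 Λ]

end Bind

/-! ### Finite-volume Gibbs distributions of a bounded potential are probability measures -/

section Potential

variable {S : Type*}

omit [DecidableEq V] [G.LocallyFinite] in
/-- A potential with bounded interaction terms, `|Φ_A| ≤ C_A`, has a bounded finite-volume
Hamiltonian: `|H_Λ^Φ(σ)| ≤ ∑_{A ∈ supp Λ, A ∩ Λ ≠ ∅} C_A` (Georgii 2011, (2.11);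
Friedli–Velenik 2017, §6.3.2, `‖H_{Λ;Φ}‖_∞ < ∞` after (6.25)). [cite: Georgii2011, eq. (2.11)] -/
theorem abs_hamiltonianIn_le [DecidableEq V] {Φ : Potential V S} {C : Finset V → ℝ}
    (hC : ∀ A σ, |Φ A σ| ≤ C A) (supp : Finset V → Finset (Finset V)) (Λ : Finset V)
    (σ : V → S) :
    |hamiltonianIn Φ supp Λ σ| ≤ ∑ A ∈ supp Λ with (A ∩ Λ).Nonempty, C A :=
  (Finset.abs_sum_le_sum_abs _ _).trans (Finset.sum_le_sum fun A _ => hC A σ)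

variable [MeasurableSpace S]

omit [DecidableEq V] [G.LocallyFinite] in
/-- The reference measure `ν^{⊗Λ} ∘ glueWith⁻¹` of the Gibbsian specification of a potential is
nonzero as soon as the a priori measure `ν` is a nonzero finite measure (its total mass is
`ν(S)^{|Λ|} ≠ 0`) (Georgii 2011, Def. 2.9; Friedli–Velenik 2017, §6.3.2, (6.31)).
[cite: Georgii2011, Def. 2.9] -/
theorem map_glueWith_pi_ne_zero (ν : Measure S) [IsFiniteMeasure ν] (hν : ν ≠ 0) (Λ : Finset V)
    (η : V → S) : (Measure.pi fun _ : Λ => ν).map (glueWith Λ · η) ≠ 0 := by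
  rw [Measure.map_ne_zero_iff (measurable_glueWith Λ η).aemeasurable]
  intro h
  have h1 := congrArg (fun m : Measure (Λ → S) => m Set.univ) h
  simp only [Measure.pi_univ, Measure.coe_zero, Pi.zero_apply, Finset.prod_eq_zero_iff,
    Measure.measure_univ_eq_zero] at h1
  obtain ⟨_, -, h2⟩ := h1
  exact hν h2

omit [DecidableEq V] [G.LocallyFinite] in
/-- For measurable interaction terms the finite-volume Hamiltonian `H_Λ^Φ` is measurable, being a
finite sum of measurable functions (Georgii 2011, (2.11); Friedli–Velenik 2017, Def. 6.14 and
(6.24)). [cite: Georgii2011, eq. (2.11)] -/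
@[fun_prop]
theorem measurable_hamiltonianIn [DecidableEq V] {Φ : Potential V S} (hΦ : ∀ A, Measurable (Φ A))
    (supp : Finset V → Finset (Finset V)) (Λ : Finset V) :
    Measurable (hamiltonianIn Φ supp Λ) := by
  unfold hamiltonianIn
  exact Finset.measurable_sum _ fun A _ => hΦ A

omit [DecidableEq V] [G.LocallyFinite] in
/-- **Discharge of `isProbabilityMeasure_gibbsSpecOfPotential`** (Georgii 2011, Def. 2.9 with
(2.9); Friedli–Velenik 2017, §6.3.2, (6.30)–(6.31) and Lemma 6.15): for a nonzero finite a priori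
measure `ν` and a potential with measurable, bounded interaction terms, the finite-volume Gibbs
distribution `gibbsSpecOfPotential ν Φ supp β Λ η` is a probability measure, for every real `β`,
every volume `Λ` and every boundary condition `η`. Proof: the reference measure
`ν^{⊗Λ} ∘ glueWith⁻¹` is finite and nonzero (`map_glueWith_pi_ne_zero`), and the Boltzmann weight
`exp (-β H_Λ^Φ)` is measurable (`measurable_hamiltonianIn`) and bounded by
`exp (|β| ∑_A C_A)` (`abs_hamiltonianIn_le`), hence integrable against a finite measure
(Mathlib `Integrable.of_bound`); so the normaliser `Z_Λ(η) = ∫ exp (-β H_Λ^Φ)` is finite and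
positive and Mathlib's `isProbabilityMeasure_tilted` applies — the `Measure.tilted` junk value is
not hit. [cite: Georgii2011, Def. 2.9 with (2.9)] -/
theorem isProbabilityMeasure_gibbsSpecOfPotential_holds :
    isProbabilityMeasure_gibbsSpecOfPotential (V := V) (S := S) := by
  intro _ ν _ hν Φ hΦ hΦb supp β Λ η
  choose C hC using hΦb
  haveI : NeZero ((Measure.pi fun _ : Λ => ν).map (glueWith Λ · η)) :=
    ⟨map_glueWith_pi_ne_zero ν hν Λ η⟩
  have hmeas : Measurable fun σ : V → S => Real.exp (-β * hamiltonianIn Φ supp Λ σ) :=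
    Real.measurable_exp.comp ((measurable_hamiltonianIn hΦ supp Λ).const_mul _)
  have hbound : ∀ σ : V → S, ‖Real.exp (-β * hamiltonianIn Φ supp Λ σ)‖ ≤
      Real.exp (|β| * ∑ A ∈ supp Λ with (A ∩ Λ).Nonempty, C A) := fun σ => by
    rw [Real.norm_eq_abs, Real.abs_exp, Real.exp_le_exp]
    calc -β * hamiltonianIn Φ supp Λ σ ≤ |-β * hamiltonianIn Φ supp Λ σ| := le_abs_self _
      _ = |β| * |hamiltonianIn Φ supp Λ σ| := by rw [abs_mul, abs_neg]
      _ ≤ |β| * ∑ A ∈ supp Λ with (A ∩ Λ).Nonempty, C A :=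
          mul_le_mul_of_nonneg_left (abs_hamiltonianIn_le hC supp Λ σ) (abs_nonneg β)
  unfold gibbsSpecOfPotential
  exact isProbabilityMeasure_tilted
    (Integrable.of_bound hmeas.aestronglyMeasurable _ (ae_of_all _ hbound))

end Potential

/-! ### Convexity of `𝒢(γ)`: discharge of `convex_gibbsMeasures` -/

section Convex

variable {S : Type*} [MeasurableSpace S]

omit [DecidableEq V] [G.LocallyFinite] in
/-- **Discharge of `convex_gibbsMeasures`: `𝒢(γ)` is convex** (Georgii 2011, Ch. 7, (7.1);
Friedli–Velenik 2017, §6.8, Thm. 6.56, whose printed proof is the one-liner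
`μ π_Λ = λ ν₁ π_Λ + (1 - λ) ν₂ π_Λ = λ ν₁ + (1 - λ) ν₂ = μ`). For `μ, ν ∈ 𝒢(γ)` and `a, b ∈ ℝ≥0∞`
with `a + b = 1`, the combination `a • μ + b • ν` has total mass `a + b = 1`, and for every finite
`Λ` and measurable `A`,
`∫ γ_Λ(A | η) d(a • μ + b • ν)(η) = a ∫ γ_Λ(A | ·) dμ + b ∫ γ_Λ(A | ·) dν = a μ(A) + b ν(A)
= (a • μ + b • ν)(A)` (linearity of `μ ↦ μ γ_Λ`: `lintegral_add_measure`,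
`lintegral_smul_measure`). As in the sources, no hypothesis on `γ` (not even
`IsSpecification γ`) is needed. [cite: Georgii2011, Ch. 7 (7.1)] -/
theorem convex_gibbsMeasures_holds : convex_gibbsMeasures (V := V) (S := S) := by
  intro γ μ hμ ν hν a b _ _ hab
  refine ⟨⟨?_⟩, fun Λ A hA => ?_⟩
  · haveI := hμ.1
    haveI := hν.1
    simp [hab]
  · rw [lintegral_add_measure, lintegral_smul_measure, lintegral_smul_measure, hμ.2 Λ A hA,
      hν.2 Λ A hA]
    simp

end Convex

end Literature.Probability.LatticeModels

end
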